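import Mathlib
import Summits.CriticalPhenomena.SAWScalingLimit.Theses.SAWTotalPositivity

/-!
# Sketch — first lemmas of the three crux ideas for `SAWTotalPositivity.BoundaryTP2`
(crux stmt-CriticalPhenomena-7115; planner-cruxidea-…-7115-2-0, round 1)

All statements are `def … : Prop` over existing declarations (no sorry); they are the
"First lemma" lines of the cards `Ideas/corner-deletion-induction.md`,
`Ideas/third-pairing-skeleton.md`, `Ideas/switchback-defect-gas.md`.
Notation: `Z a b S` = critical weight of the SAWs `a → b` of `Ω_δ` lying in the set `S`
(`SAW.weight`), `Zx x a b S` = the same at fugacity `x` (inline, as in `EdgeOfPositivity`).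
-/

namespace Summit.CriticalPhenomena.SAWScalingLimit.Cruxes.BoundaryTP2.Ideas

open scoped BigOperators Classical ENNReal
open Literature.Probability.RandomPlanarGeometry Literature.Probability.LatticeModels

/-- The interlacing hypotheses (i)–(iii) of `BoundaryTP2`, verbatim, bundled. -/
def Interlaced (Ω : Set ℂ) (δ : ℝ) (p₁ p₂ p₃ p₄ : Site 2) : Prop :=
  (∀ (P : SAW.DomainSAW Ω δ p₁ p₃) (Q : SAW.DomainSAW Ω δ p₂ p₄),
      ∃ v, v ∈ P.walk.support ∧ v ∈ Q.walk.support) ∧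
  (∃ (P : SAW.DomainSAW Ω δ p₁ p₂) (Q : SAW.DomainSAW Ω δ p₃ p₄),
      List.Disjoint P.walk.support Q.walk.support) ∧
  (∃ (P : SAW.DomainSAW Ω δ p₁ p₄) (Q : SAW.DomainSAW Ω δ p₂ p₃),
      List.Disjoint P.walk.support Q.walk.support)

/-- Fugacity-`x` weight of the SAWs `a → b` of `Ω_δ` in the set `S` (at `x = x_c` this is
`SAW.weight Ω δ a b S`, by `Measure.sum_apply`). -/
noncomputable def Zx (x : ℝ) (Ω : Set ℂ) (δ : ℝ) (a b : Site 2)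
    (S : Set (SAW.DomainSAW Ω δ a b)) : ℝ≥0∞ :=
  ∑' γ : SAW.DomainSAW Ω δ a b, S.indicator (fun γ => ENNReal.ofReal (x ^ γ.length)) γ

/-! ## Card 1 — corner-deletion induction -/

/-- FIRST-STEP IDENTITY at the corner `p₃` (provable now; the backbone of the recursion):
`Z(p₃,t) = x_c · Σ_{u ∼ p₃} Z(u, t ∣ avoiding p₃)`. -/
def FirstStep : Prop :=
  ∀ (Ω : Set ℂ) (δ : ℝ) (p₃ t : Site 2), p₃ ≠ t →
    SAW.weight Ω δ p₃ t Set.univ =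
      ENNReal.ofReal SAW.criticalFugacity *
        ∑' u : Site 2, if (discreteDomainGraph Ω δ).Adj p₃ u then
          SAW.weight Ω δ u t {γ | p₃ ∉ γ.walk.support} else 0

/-- CORNER RECURSION (provable from `FirstStep` and `Z = Z(∣ avoids p₃) + Z(∣ visits p₃)`),
written additively in `ℝ≥0∞`:
`Z₁₂Z₃₄ + x·Σ_u A₁ᵤA₂₄ + V₂₄Z₁₃ = Z₁₃Z₂₄ + x·Σ_u A₁₂Aᵤ₄ + V₁₂Z₃₄`,
`A` = avoiding `p₃`, `V` = visiting `p₃`; i.e. `det_G = x Σ_{u∼p₃} det_{G−p₃}(p₁,p₂,u,p₄) + (V₁₂Z₃₄ − V₂₄Z₁₃)`. -/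
def CornerRecursion : Prop :=
  ∀ (Ω : Set ℂ) (δ : ℝ) (p₁ p₂ p₃ p₄ : Site 2), p₃ ≠ p₁ → p₃ ≠ p₂ → p₃ ≠ p₄ →
    let Z : (a b : Site 2) → ℝ≥0∞ := fun a b => SAW.weight Ω δ a b Set.univ
    let A : (a b : Site 2) → ℝ≥0∞ := fun a b => SAW.weight Ω δ a b {γ | p₃ ∉ γ.walk.support}
    let V : (a b : Site 2) → ℝ≥0∞ := fun a b => SAW.weight Ω δ a b {γ | p₃ ∈ γ.walk.support}
    let xc : ℝ≥0∞ := ENNReal.ofReal SAW.criticalFugacity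
    Z p₁ p₂ * Z p₃ p₄ + xc * (∑' u : Site 2, if (discreteDomainGraph Ω δ).Adj p₃ u then A p₁ u * A p₂ p₄ else 0)
        + V p₂ p₄ * Z p₁ p₃ =
      Z p₁ p₃ * Z p₂ p₄ + xc * (∑' u : Site 2, if (discreteDomainGraph Ω δ).Adj p₃ u then A p₁ p₂ * A u p₄ else 0)
        + V p₁ p₂ * Z p₃ p₄

/-- STRICT CORNER DOMINATION (the line's bet; Transfer `C⁺`): uniformly in the finite subgraph,
in the interlaced quadruple and in `x ∈ (0, x_c]`, the corner correction is at most a fixed fraction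
`1 − θ` of the inductive main term: `V₂₄Z₁₃ − V₁₂Z₃₄ ≤ (1 − θ) · x Σ_{u∼p₃} det_{G−p₃}(p₁,p₂,u,p₄)`
(additive `ℝ≥0∞` form below). Observed: `θ ≈ 0.69` at `x_c` on 3 600+ cases, no size drift.
With `θ = 0` it is equivalent to `BoundaryTP2` by induction on `|Ω_δ|`; `θ > 0` is the slack. -/
def StrictCornerDomination : Prop :=
  ∃ θ : ℝ, 0 < θ ∧ ∀ (x : ℝ), 0 < x → x ≤ SAW.criticalFugacity →
    ∀ (Ω : Set ℂ) (δ : ℝ) (p₁ p₂ p₃ p₄ : Site 2), Bornology.IsBounded Ω → 0 < δ →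
      Interlaced Ω δ p₁ p₂ p₃ p₄ →
      let Z : (a b : Site 2) → ℝ≥0∞ := fun a b => Zx x Ω δ a b Set.univ
      let A : (a b : Site 2) → ℝ≥0∞ := fun a b => Zx x Ω δ a b {γ | p₃ ∉ γ.walk.support}
      let V : (a b : Site 2) → ℝ≥0∞ := fun a b => Zx x Ω δ a b {γ | p₃ ∈ γ.walk.support}
      let κ : ℝ≥0∞ := ENNReal.ofReal ((1 - θ) * x)
      V p₂ p₄ * Z p₁ p₃ + κ * (∑' u : Site 2, if (discreteDomainGraph Ω δ).Adj p₃ u then A p₁ u * A p₂ p₄ else 0) ≤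
        V p₁ p₂ * Z p₃ p₄ + κ * (∑' u : Site 2, if (discreteDomainGraph Ω δ).Adj p₃ u then A p₁ p₂ * A u p₄ else 0)

/-! ## Card 2 — third-pairing skeleton: the reversed-meeting lemma -/

/-- REVERSED MEETING (purely topological, provable now; the only use of hypothesis (i)):
for an interlaced quadruple and any nested pair `α : p₁ → p₂`, `β : p₃ → p₄` that meet, `β` passes
through the LAST `α`-meeting point no later than through the FIRST one (else the skeleton
`α[p₁,v']·β[p₃,v']⁻¹`, `β[w',p₄]⁻¹·α[w',p₂]` would be a vertex-disjoint CROSSING pair). -/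
def ReversedMeeting : Prop :=
  ∀ (Ω : Set ℂ) (δ : ℝ) (p₁ p₂ p₃ p₄ : Site 2),
    (∀ (P : SAW.DomainSAW Ω δ p₁ p₃) (Q : SAW.DomainSAW Ω δ p₂ p₄),
        ∃ v, v ∈ P.walk.support ∧ v ∈ Q.walk.support) →
    ∀ (α : SAW.DomainSAW Ω δ p₁ p₂) (β : SAW.DomainSAW Ω δ p₃ p₄) (v w : Site 2),
      (α.walk.support.filter fun z => z ∈ β.walk.support).head? = some v →
      (α.walk.support.filter fun z => z ∈ β.walk.support).getLast? = some w →
      β.walk.support.idxOf w ≤ β.walk.support.idxOf v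

/-! ## Card 3 — switchback defect gas: the first-meeting switching identity -/

/-- FIRST-MEETING SWITCHING IDENTITY (provable now, all fugacities; validated by enumeration):
with `v` = first vertex of `γ : p₁ → p₃` on `γ' : p₂ → p₄`, the switch
`(γ, γ') ↦ (γ[p₁,v]·γ'[v,p₂], γ[p₃,v]·γ'[v,p₄])` is a weight-preserving bijection from the crossing
pairs whose tails after `v` are disjoint onto the meeting nested pairs whose tails after their first
meeting are disjoint; hence `Z₁₂Z₃₄ + C_bad = Z₁₃Z₂₄ + D + N_bad` (under hypothesis (i): every crossing
pair meets). -/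
def FirstMeetingIdentity : Prop :=
  ∀ (x : ℝ) (Ω : Set ℂ) (δ : ℝ) (p₁ p₂ p₃ p₄ : Site 2), 0 < x →
    (∀ (P : SAW.DomainSAW Ω δ p₁ p₃) (Q : SAW.DomainSAW Ω δ p₂ p₄),
        ∃ v, v ∈ P.walk.support ∧ v ∈ Q.walk.support) →
    let w : {a b : Site 2} → SAW.DomainSAW Ω δ a b → ℝ≥0∞ := fun γ => ENNReal.ofReal (x ^ γ.length)
    -- tails strictly after the first common vertex (first along the FIRST argument) meet again
    let bad : {a b c d : Site 2} → SAW.DomainSAW Ω δ a b → SAW.DomainSAW Ω δ c d → Prop :=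
      fun γ γ' => ∃ v, (γ.walk.support.filter fun z => z ∈ γ'.walk.support).head? = some v ∧
        ∃ z, z ∈ γ.walk.support.drop (γ.walk.support.idxOf v + 1) ∧
             z ∈ γ'.walk.support.drop (γ'.walk.support.idxOf v + 1)
    let Z : (a b : Site 2) → ℝ≥0∞ := fun a b => Zx x Ω δ a b Set.univ
    let D : ℝ≥0∞ := ∑' (α : SAW.DomainSAW Ω δ p₁ p₂) (β : SAW.DomainSAW Ω δ p₃ p₄),
      if List.Disjoint α.walk.support β.walk.support then w α * w β else 0
    let Nbad : ℝ≥0∞ := ∑' (α : SAW.DomainSAW Ω δ p₁ p₂) (β : SAW.DomainSAW Ω δ p₃ p₄),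
      if bad α β then w α * w β else 0
    let Cbad : ℝ≥0∞ := ∑' (γ : SAW.DomainSAW Ω δ p₁ p₃) (γ' : SAW.DomainSAW Ω δ p₂ p₄),
      if bad γ γ' then w γ * w γ' else 0
    Z p₁ p₂ * Z p₃ p₄ + Cbad = Z p₁ p₃ * Z p₂ p₄ + D + Nbad

/-- Sanity link: at `θ = 0` the domination is exactly what the induction needs; recorded as the
implication to be proved in the plan stage (induction on the number of vertices of `Ω_δ`). -/
def InductionCloses : Prop :=
  CornerRecursion → StrictCornerDomination →
    Summit.CriticalPhenomena.SAWScalingLimit.Theses.SAWTotalPositivity.BoundaryTP2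

end Summit.CriticalPhenomena.SAWScalingLimit.Cruxes.BoundaryTP2.Ideas
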